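import Mathlib
import Summits.KontsevichZagierPeriods.KontsevichZagierPeriods.Theorems.SoloInformedPellAbelCircLaw
import Summits.KontsevichZagierPeriods.KontsevichZagierPeriods.Theorems.SoloInformedDecidedHulls
import Summits.KontsevichZagierPeriods.KontsevichZagierPeriods.Theorems.SoloInformedKummerTorsionThreeCircKernel
import HarnessLib
import HarnessLib.Audit

/-!
# COROLLARY XXIX.9: the circular order-three torsion packet of the third kind

The circular order-three Pell–Abel datum (`SoloInformedKummerTorsionThreeCircKernel`) is a
`SoloInformedPellAbelCirc` for every real algebraic `r` with `1/3 < r² < 1`, `0 < r`; THEOREM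
XXXI (`soloInformed_pellAbelCirc_law`) then gives, for ALL representations,

  **COROLLARY XXIX.9.** `⟦Π(n(r) | m(r))⟧ = ⟦[pt, 2/(3(1+r²))]⟧·⟦K(m(r))⟧
                          + ⟦[pt, 4r³/(3(1+r²)(3r²−1))]⟧·⟦π⟧` in `P`,

with `m(r) = (1−r²)³(3r²+1)/(16r⁶)`, `n(r) = (1−r²)(3r²+1)/(4r²)` (`m < n < 1`: the circular
case, where the complete integral of the third kind is NOT an algebraic multiple of `K`).
The fibre `r = 3/4`: `825·Π(301/576 | 14749/186624) = 352·K(14749/186624) + 432·π`.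
-/

noncomputable section

open MeasureTheory Set Filter
open scoped Classical

open Literature.NumberTheory.Transcendental Literature.NumberTheory.Transcendental.KZ
open Literature.ModelTheory.ExponentialFields

namespace Summit.KontsevichZagierPeriods.KontsevichZagierPeriods.Theorems

/-! ### The circular order-three Pell–Abel datum -/

/-- **The circular order-three Pell–Abel datum** along `1/3 < r² < 1`, `0 < r` (`r` algebraic).
[this work] -/
def soloInformedC3Datum (r : ℝ) (hr : 1 < 3 * r ^ 2) (hr' : r ^ 2 < 1) (h0 : 0 < r)
    (hra : IsAlgebraic ℚ r) : SoloInformedPellAbelCirc where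
  m := soloInformedC3m r
  n := soloInformedC3n r
  q₀ := soloInformedC3q0 r
  q₂ := soloInformedC3q2 r
  A := soloInformedC3A r
  A' := fun t => -(soloInformedC3m r * (2 * t)) * (1 + soloInformedC3a r * t ^ 2) +
    (1 - soloInformedC3m r * t ^ 2) * (soloInformedC3a r * (2 * t))
  B := soloInformedC3B r
  B' := fun _ => soloInformedC3b r * 1
  R := fun t => (1 - soloInformedC3m r * t ^ 2) * (1 - soloInformedC3n r * t ^ 2) ^ 2
  m_mem := soloInformed_c3_m_mem hr hr'
  n_mem := soloInformed_c3_n_mem hr hr'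
  m_isAlgebraic := (soloInformed_c3_isAlgebraic hra).1
  n_isAlgebraic := (soloInformed_c3_isAlgebraic hra).2.1
  q₀_isAlgebraic := (soloInformed_c3_isAlgebraic hra).2.2.2.2.1
  q₂_isAlgebraic := (soloInformed_c3_isAlgebraic hra).2.2.2.2.2.1
  hasDerivAt_A := fun t => by
    show HasDerivAt (fun t => soloInformedC3A r t) _ t
    unfold soloInformedC3A
    exact (((soloInformed_hasDerivAt_sq t).const_mul _).const_sub 1).mul
      (((soloInformed_hasDerivAt_sq t).const_mul _).const_add 1)
  hasDerivAt_B := fun t => by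
    show HasDerivAt (fun t => soloInformedC3B r t) _ t
    unfold soloInformedC3B
    exact (hasDerivAt_id' t).const_mul _
  continuous_A' := by fun_prop
  continuous_B' := by fun_prop
  norm := fun t => soloInformed_c3_norm h0.ne' t
  num := fun t => by
    have h := soloInformed_c3_numerator h0.ne' t
    linear_combination h
  R_pos := fun t ht => soloInformed_c3_R_pos hr hr' ht
  A_zero := (soloInformed_c3_A_ends hr hr').1
  A_one := (soloInformed_c3_A_ends hr hr').2
  B_zero := by simp [soloInformedC3B]
  B_pos := fun t ht => by
    show 0 < soloInformedC3b r * t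
    exact mul_pos (soloInformed_c3_b_pos hr h0) ht.1
  res := (soloInformed_c3_res_pos hr hr' h0).ne'
  sa_A := fun S hS i => (soloInformed_c3_sa hS hra i).1
  sa_A' := fun S hS i => (soloInformed_c3_sa hS hra i).2.1
  sa_B := fun S hS i => (soloInformed_c3_sa hS hra i).2.2.1
  sa_B' := fun S hS i => (soloInformed_c3_sa hS hra i).2.2.2

/-- The datum's constants are `α(r)` and `β(r)`. [this work] -/
theorem soloInformed_c3_datum_alpha_beta {r : ℝ} (hr : 1 < 3 * r ^ 2) (hr' : r ^ 2 < 1) (h0 : 0 < r)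
    (hra : IsAlgebraic ℚ r) :
    (soloInformedC3Datum r hr hr' h0 hra).alpha = soloInformedC3alpha r ∧
    (soloInformedC3Datum r hr hr' h0 hra).beta = soloInformedC3beta r :=
  soloInformed_c3_alpha_beta_eq hr hr' h0

/-! ### COROLLARY XXIX.9 -/

/-- `α(r)` and `2β(r)` are algebraic for algebraic `r`. [folklore] -/
theorem soloInformed_c3_consts_isAlgebraic {r : ℝ} (hra : IsAlgebraic ℚ r) :
    IsAlgebraic ℚ (soloInformedC3alpha r) ∧ IsAlgebraic ℚ (2 * soloInformedC3beta r) := by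
  obtain ⟨-, -, -, -, -, -, hα, hβ⟩ := soloInformed_c3_isAlgebraic hra
  exact ⟨hα, (show IsAlgebraic ℚ (2:ℝ) by exact_mod_cast isAlgebraic_nat (R := ℚ) (A := ℝ) 2).mul hβ⟩

/-- **COROLLARY XXIX.9 (the circular order-three torsion packet of the third kind).**  For real
algebraic `r` with `1 < 3r²`, `r² < 1`, `0 < r`, and `m = m(r)`, `n = n(r)` as above: for ALL
representations `Π_n = [(0,1), κ_m/(1−nx²)]`, `K = [(0,1), κ_m]`,
`⟦Π_n⟧ = ⟦[pt, 2/(3(1+r²))]⟧·⟦K⟧ + ⟦[pt, 4r³/(3(1+r²)(3r²−1))]⟧·⟦π⟧` in `P`. [this work] -/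
theorem soloInformed_kummer_torsionThreeCirc (r : ℝ) (hr : 1 < 3 * r ^ 2) (hr' : r ^ 2 < 1)
    (h0 : 0 < r) (hra : IsAlgebraic ℚ r) (PN K : IntegralRep 1)
    (hPNd : PN.domain = {x | x 0 ∈ Ioo (0:ℝ) 1})
    (hPNi : EqOn PN.integrand (fun x => (1 - soloInformedC3n r * x 0 ^ 2)⁻¹ *
      ((√(1 - x 0 ^ 2))⁻¹ * (√(1 - soloInformedC3m r * x 0 ^ 2))⁻¹)) PN.domain)
    (hKd : K.domain = {x | x 0 ∈ Ioo (0:ℝ) 1})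
    (hKi : EqOn K.integrand (fun x => (√(1 - x 0 ^ 2))⁻¹ * (√(1 - soloInformedC3m r * x 0 ^ 2))⁻¹)
      K.domain) :
    toFormalPeriod (of PN) =
      toFormalPeriod (of (IntegralRep.unit.constMul (soloInformedC3alpha r)
        (soloInformed_c3_consts_isAlgebraic hra).1)) * toFormalPeriod (of K) +
      toFormalPeriod (of (IntegralRep.unit.constMul (2 * soloInformedC3beta r)
        (soloInformed_c3_consts_isAlgebraic hra).2)) * toFormalPeriod (of piRep) := by
  obtain ⟨hα, hβ⟩ := soloInformed_c3_datum_alpha_beta hr hr' h0 hra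
  have hβ2 : 2 * (soloInformedC3Datum r hr hr' h0 hra).beta = 2 * soloInformedC3beta r := by rw [hβ]
  have h := soloInformed_pellAbelCirc_law (soloInformedC3Datum r hr hr' h0 hra) PN K hPNd hPNi hKd hKi
  rw [h, soloInformed_pointRep_congr _ (soloInformed_c3_consts_isAlgebraic hra).1 hα,
    soloInformed_pointRep_congr _ (soloInformed_c3_consts_isAlgebraic hra).2 hβ2]

/-- **COROLLARY XXIX.9 in values**: `Π(n(r) | m(r)) = 2K(m(r))/(3(1+r²)) + 4r³π/(3(1+r²)(3r²−1))`.
[this work] -/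
theorem soloInformed_kummer_torsionThreeCirc_value (r : ℝ) (hr : 1 < 3 * r ^ 2) (hr' : r ^ 2 < 1)
    (h0 : 0 < r) (hra : IsAlgebraic ℚ r) (PN K : IntegralRep 1)
    (hPNd : PN.domain = {x | x 0 ∈ Ioo (0:ℝ) 1})
    (hPNi : EqOn PN.integrand (fun x => (1 - soloInformedC3n r * x 0 ^ 2)⁻¹ *
      ((√(1 - x 0 ^ 2))⁻¹ * (√(1 - soloInformedC3m r * x 0 ^ 2))⁻¹)) PN.domain)
    (hKd : K.domain = {x | x 0 ∈ Ioo (0:ℝ) 1})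
    (hKi : EqOn K.integrand (fun x => (√(1 - x 0 ^ 2))⁻¹ * (√(1 - soloInformedC3m r * x 0 ^ 2))⁻¹)
      K.domain) :
    PN.value = soloInformedC3alpha r * K.value + 2 * soloInformedC3beta r * Real.pi := by
  have h := congrArg evalP (soloInformed_kummer_torsionThreeCirc r hr hr' h0 hra PN K hPNd hPNi hKd hKi)
  simpa only [map_mul, map_add, evalP_toFormalPeriod_of, IntegralRep.value_constMul,
    IntegralRep.value_unit, mul_one, piRep_value] using h

/-- **The two representations exist**, and satisfy the law. [this work] -/
theorem soloInformed_kummer_torsionThreeCirc_exists (r : ℝ) (hr : 1 < 3 * r ^ 2) (hr' : r ^ 2 < 1)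
    (h0 : 0 < r) (hra : IsAlgebraic ℚ r) :
    ∃ PN K : IntegralRep 1,
      PN.domain = {x | x 0 ∈ Ioo (0:ℝ) 1} ∧
      (∀ x, PN.integrand x = (1 - soloInformedC3n r * x 0 ^ 2)⁻¹ *
        ((√(1 - x 0 ^ 2))⁻¹ * (√(1 - soloInformedC3m r * x 0 ^ 2))⁻¹)) ∧
      K.domain = {x | x 0 ∈ Ioo (0:ℝ) 1} ∧
      (∀ x, K.integrand x = (√(1 - x 0 ^ 2))⁻¹ * (√(1 - soloInformedC3m r * x 0 ^ 2))⁻¹) ∧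
      PN.value = soloInformedC3alpha r * K.value + 2 * soloInformedC3beta r * Real.pi := by
  have hm := soloInformed_c3_m_mem hr hr'
  have hn := soloInformed_c3_n_mem hr hr'
  obtain ⟨hma, hna, -, -, -, -, -, -⟩ := soloInformed_c3_isAlgebraic hra
  obtain ⟨PN, hPNd, hPNi⟩ := soloInformed_exists_ellipticPi_rep_of_lt_one _ _ hn.2 hna hm hma
  obtain ⟨K, hKd, hKi⟩ := soloInformed_exists_ellipticK_rep _ hm hma
  exact ⟨PN, K, hPNd, hPNi, hKd, hKi, soloInformed_kummer_torsionThreeCirc_value r hr hr' h0 hra PN K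
    hPNd (fun x _ => hPNi x) hKd (fun x _ => hKi x)⟩

/-- **The fibre `r = 3/4`**: `825·Π(301/576 | 14749/186624) = 352·K(14749/186624) + 432·π` for
all representations. [this work] -/
theorem soloInformed_kummer_torsionThreeCirc_fibre (PN K : IntegralRep 1)
    (hPNd : PN.domain = {x | x 0 ∈ Ioo (0:ℝ) 1})
    (hPNi : EqOn PN.integrand (fun x => (1 - 301 / 576 * x 0 ^ 2)⁻¹ *
      ((√(1 - x 0 ^ 2))⁻¹ * (√(1 - 14749 / 186624 * x 0 ^ 2))⁻¹)) PN.domain)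
    (hKd : K.domain = {x | x 0 ∈ Ioo (0:ℝ) 1})
    (hKi : EqOn K.integrand (fun x => (√(1 - x 0 ^ 2))⁻¹ * (√(1 - 14749 / 186624 * x 0 ^ 2))⁻¹)
      K.domain) :
    825 * PN.value = 352 * K.value + 432 * Real.pi := by
  have hm : soloInformedC3m (3 / 4) = 14749 / 186624 := by norm_num [soloInformedC3m]
  have hn : soloInformedC3n (3 / 4) = 301 / 576 := by norm_num [soloInformedC3n]
  have hα : soloInformedC3alpha (3 / 4) = 32 / 75 := by norm_num [soloInformedC3alpha]
  have hβ : soloInformedC3beta (3 / 4) = 72 / 275 := by norm_num [soloInformedC3beta]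
  have h34 : IsAlgebraic ℚ ((3 : ℝ) / 4) := by
    have h := isAlgebraic_algebraMap (R := ℚ) (A := ℝ) (3 / 4 : ℚ)
    simpa using h
  have h := soloInformed_kummer_torsionThreeCirc_value (3 / 4) (by norm_num) (by norm_num) (by norm_num)
    h34 PN K hPNd (by simp only [hm, hn]; exact hPNi) hKd (by simp only [hm]; exact hKi)
  rw [h, hα, hβ]
  ring

end Summit.KontsevichZagierPeriods.KontsevichZagierPeriods.Theorems

end
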